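import Summits.ValiantsHypothesis.ValiantsHypothesis.Theorems.NcUnbalancedRank
import HarnessLib

/-!
# The unbalance dial is strict, lower side: powers of nested palindromes

Workshop file for the node `CommutativityDial` (decomp-valiant lens 6 «restricted-models lifting axis»;
offer O-L6-14 «THE UNBALANCE DIAL IS STRICT», FILE 1 of 2; FILE 2 = `NcPalindromePowerWitness`).
Nisan (1991) observed that the palindrome polynomial has linear-size SKEW circuits although its
partial-derivative matrix has full rank; Limaye–Malod–Srinivasan (ToC 12 (2016), §1 p. 7, Cor. 5.7,
Thm 5.5) remark that the SQUARE of a palindrome polynomial is exponentially hard for skew circuits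
and for `δ`-unbalanced circuits (`δ ≤ d/5`), while one non-skew gate computes it cheaply. This file is
the LOWER side of that separation, in the kernel, for every power `k = j + 2` and every notch `w` of
the unbalance dial of `NcUnbalancedStructure` / `NcUnbalancedRank`:

* §1 a coefficient toolkit (`coeff_append_mul`: the cut formula for homogeneous factors at any
  degree; `coeff_sandwich`: `[a u a'] (x · f · x') = [x = a][x' = a'] · [u] f`);
* §2 the NESTED PALINDROME `PAL_t = Σ_{|u| = t} u · uᴿ` over the letters `{0, 1}`, defined
  recursively (`palPoly`), homogeneous of degree `2t`, with `[l ++ l'ᴿ] PAL_t = [l = l']`;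
* §3 its powers: `PAL_t^{j+2}` is homogeneous of degree `d = 2tj + 4t` and
  `[A ++ A'ᴿ ++ 0^{2tj} ++ B'ᴿ ++ B] PAL_t^{j+2} = [A = A'][B = B']` (`coeff_glue_palPow`);
* §4 hence the outer flattening at `p = t`, `m = 2tj + 2t` (rows `(A, B)`, columns `C`, entry
  `[A C B] f`, `NcSkewPermanent.outerFlat`) has a `0/1` right inverse (`palSel`) and FULL ROW RANK `4^t`;
* §5 **`PAL_t^{j+2}` IS EXPONENTIALLY HARD AT EVERY NOTCH** (`palPow_unbalanced`, `palPow_degree`):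
  every fan-in-two noncommutative circuit computing `PAL_t^{j+2}` (`t ≥ 1`) whose product gates are
  `(w+2)`-unbalanced up to degree `2tj + 4t` has **`2^t ≤ (t+1) · (w+1) 2^w · size`**; skew circuits
  (`w = 0`): `2^t ≤ (t+1) · size` (`palPow_skew`).

FILE 2 supplies the UPPER side: for `2t ≤ w + 1` there are such circuits of size `≤ 5t + j + 1`.
HONEST FRAMING: restricted models only; `A_nc` (stmt-23446), `D2`, `per_n` / `det_n` lower bounds for
general nc circuits, `VP ≠ VNP` untouched and proved by nothing here; mechanism PRINT (Nisan 1991;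
LMS16 §1 p7 remark, Def 5.6, Cor 5.7, Thm 5.5); the general power `j+2` and the explicit constants are
bookkeeping (new only in the kernel: no palindrome polynomial was in the tree).
-/

noncomputable section

namespace Summit.ValiantsHypothesis.ValiantsHypothesis.Theorems.NcPalindromePower

open Literature.Computability.AlgebraicComplexity Literature.Computability.AlgebraicComplexity.ArithCircuit
open Summit.ValiantsHypothesis.ValiantsHypothesis.Theorems.NcAutomatonIntersection
  Summit.ValiantsHypothesis.ValiantsHypothesis.Theorems.NcCentralWidth
  Summit.ValiantsHypothesis.ValiantsHypothesis.Theorems.NcSOSDegreeFour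
  Summit.ValiantsHypothesis.ValiantsHypothesis.Theorems.NcBlockForms
  Summit.ValiantsHypothesis.ValiantsHypothesis.Theorems.NcCayleyDeterminant
  Summit.ValiantsHypothesis.ValiantsHypothesis.Theorems.NcSOSPermanent
  Summit.ValiantsHypothesis.ValiantsHypothesis.Theorems.NcSkewStructure
  Summit.ValiantsHypothesis.ValiantsHypothesis.Theorems.NcSkewPermanent
  Summit.ValiantsHypothesis.ValiantsHypothesis.Theorems.NcUnbalancedStructure
  Summit.ValiantsHypothesis.ValiantsHypothesis.Theorems.NcUnbalancedRank

universe u v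

/-! ## §1 Coefficient toolkit -/

section Toolkit

variable {R : Type u} [CommSemiring R] {σ : Type v}

/-- The cut formula for homogeneous factors at any ambient degree: `[u v](p q) = [u]p · [v]q` for
`p`, `q` homogeneous of degrees `|u|`, `|v|`, `|u| + |v| ≤ d`. [cite: HrubesWigdersonYehudayoff2010, Prop. 2.1] -/
theorem coeff_append_mul [DecidableEq σ] {d a b : ℕ} (hab : a + b ≤ d) (u v : List σ)
    (hu : u.length = a) (hv : v.length = b) {p q : FreeAlgebra R σ} (hp : degPart d a p = p)
    (hq : degPart d b q = q) : coeff (u ++ v) (p * q) = coeff u p * coeff v q := by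
  have := coeff_mul_degPart hab (u ++ v) (by rw [List.length_append, hu, hv]) p q
  rwa [hp, hq, List.take_left' hu, List.drop_left' hu] at this

/-- A letter is homogeneous of degree `1`. [cite: HrubesWigdersonYehudayoff2010, §A] -/
theorem degPart_one_ι {d : ℕ} (hd : 1 ≤ d) (x : σ) :
    degPart (R := R) d 1 (FreeAlgebra.ι R x) = FreeAlgebra.ι R x := by
  simpa using degPart_word (R := R) hd [x]

/-- `[∅] 1 = 1`. [cite: HrubesWigdersonYehudayoff2010, §2] -/
theorem coeff_nil_one [DecidableEq σ] : coeff ([] : List σ) (1 : FreeAlgebra R σ) = 1 := by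
  simpa using coeff_word (R := R) ([] : List σ) ([] : List σ)

/-- **Sandwich**: `[a u a'] (x · f · x') = [x = a ∧ x' = a'] · [u] f`. [cite: Nisan1991Noncommutative, Lemma 1] -/
theorem coeff_sandwich [DecidableEq σ] (a a' x x' : σ) (u : List σ) (f : FreeAlgebra R σ) :
    coeff (a :: (u ++ [a'])) (FreeAlgebra.ι R x * f * FreeAlgebra.ι R x') =
      if x = a ∧ x' = a' then coeff u f else 0 := by
  induction f using word_induction with
  | h0 => simp only [mul_zero, zero_mul, map_zero, ite_self]
  | hadd f g hf hg =>
    simp only [mul_add, add_mul, map_add, hf, hg]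
    by_cases h : x = a ∧ x' = a'
    · simp only [if_pos h]
    · simp only [if_neg h, add_zero]
  | hw r v =>
    have hword : FreeAlgebra.ι R x * (v.map (FreeAlgebra.ι R)).prod * FreeAlgebra.ι R x' =
        ((x :: (v ++ [x'])).map (FreeAlgebra.ι R)).prod := by
      simp only [List.map_cons, List.map_append, List.map_nil, List.prod_cons, List.prod_append,
        List.prod_nil, mul_one, mul_assoc]
    rw [mul_smul_comm, smul_mul_assoc, map_smul, map_smul, hword, coeff_word, coeff_word]
    by_cases h : x = a ∧ x' = a'
    · rw [if_pos h]
      by_cases hv : v = u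
      · simp [h.1, h.2, hv]
      · have hne : x :: (v ++ [x']) ≠ a :: (u ++ [a']) := fun H =>
          hv (List.append_singleton_inj.mp (List.cons.inj H).2).1
        rw [if_neg hne, if_neg hv, smul_zero]
    · have hne : x :: (v ++ [x']) ≠ a :: (u ++ [a']) := fun H =>
        h ⟨(List.cons.inj H).1, (List.append_singleton_inj.mp (List.cons.inj H).2).2⟩
      rw [if_neg hne, if_neg h, smul_zero]

/-- `Σ_{x : Fin 2} [x = a ∧ x = a'] c = [a = a'] c`. [cite: Nisan1991Noncommutative, Lemma 1] -/
theorem sum_ite_and_eq {M : Type*} [AddCommMonoid M] (a a' : Fin 2) (c : M) :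
    (∑ x : Fin 2, if x = a ∧ x = a' then c else 0) = if a = a' then c else 0 := by
  have key : ∀ x : Fin 2, (if x = a ∧ x = a' then c else 0) =
      if x = a then (if a = a' then c else 0) else 0 := by
    intro x
    by_cases hx : x = a
    · subst hx
      by_cases h' : x = a' <;> simp [h']
    · simp [hx]
  rw [Finset.sum_congr rfl fun x _ => key x, Finset.sum_ite_eq', if_pos (Finset.mem_univ a)]

end Toolkit

/-! ## §2 Nested palindromes -/

section Pal

variable (R : Type u) [CommSemiring R]

/-- The NESTED PALINDROME `PAL_t = Σ_{u ∈ {0,1}^t} u · uᴿ` (Nisan's palindrome polynomial of degree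
`2t` over two letters), recursively: `PAL_0 = 1`, `PAL_{t+1} = Σ_x x · PAL_t · x`. [cite: Nisan1991Noncommutative, Lemma 1] -/
def palPoly : ℕ → FreeAlgebra R (Fin 2)
  | 0 => 1
  | t + 1 => ∑ x : Fin 2, FreeAlgebra.ι R x * palPoly t * FreeAlgebra.ι R x

/-- `PAL_0 = 1`. [cite: Nisan1991Noncommutative, Lemma 1] -/
theorem palPoly_zero : palPoly R 0 = 1 := rfl

/-- `PAL_{t+1} = Σ_x x · PAL_t · x`. [cite: Nisan1991Noncommutative, Lemma 1] -/
theorem palPoly_succ (t : ℕ) :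
    palPoly R (t + 1) = ∑ x : Fin 2, FreeAlgebra.ι R x * palPoly R t * FreeAlgebra.ι R x := rfl

/-- `PAL_t` is homogeneous of degree `2t`. [cite: Nisan1991Noncommutative, Lemma 1] -/
theorem degPart_palPoly : ∀ (t : ℕ) {d : ℕ}, 2 * t ≤ d → degPart d (2 * t) (palPoly R t) = palPoly R t := by
  intro t
  induction t with
  | zero =>
    intro d _
    rw [palPoly_zero, Nat.mul_zero]
    exact degPart_zero_one d
  | succ t ih =>
    intro d h
    rw [palPoly_succ, map_sum]
    refine Finset.sum_congr rfl fun x _ => ?_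
    have h1 : degPart (R := R) d 1 (FreeAlgebra.ι R x) = FreeAlgebra.ι R x := degPart_one_ι (by omega) x
    have h2 := degPart_mul_of_eq (degPart_mul_of_eq h1 (ih (d := d) (by omega)) (by omega)) h1
      (by omega)
    rw [show 2 * (t + 1) = 1 + 2 * t + 1 by omega]
    exact h2

/-- **Coefficients of `PAL_t`**: `[l ++ l'ᴿ] PAL_t = [l = l']` for `|l| = |l'| = t` — the matrix of
`PAL_t` w.r.t. (first half, second half) is a permutation matrix. [cite: Nisan1991Noncommutative, Lemma 1] -/
theorem coeff_palPoly : ∀ (t : ℕ) (l l' : List (Fin 2)), l.length = t → l'.length = t →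
    coeff (l ++ l'.reverse) (palPoly R t) = if l = l' then 1 else 0 := by
  intro t
  induction t with
  | zero =>
    intro l l' hl hl'
    rw [List.length_eq_zero_iff] at hl hl'
    subst hl
    subst hl'
    simpa [palPoly_zero] using coeff_nil_one (R := R) (σ := Fin 2)
  | succ t ih =>
    intro l l' hl hl'
    obtain ⟨a, u, rfl⟩ := List.exists_cons_of_length_eq_add_one hl
    obtain ⟨a', u', rfl⟩ := List.exists_cons_of_length_eq_add_one hl'
    have hu : u.length = t := by simpa using hl
    have hu' : u'.length = t := by simpa using hl'
    rw [List.reverse_cons, List.cons_append, ← List.append_assoc, palPoly_succ, map_sum]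
    simp only [coeff_sandwich, ih u u' hu hu']
    rw [sum_ite_and_eq]
    by_cases h : a = a'
    · subst h
      by_cases huu : u = u'
      · subst huu
        simp
      · rw [if_pos rfl, if_neg huu, if_neg (fun H => huu (List.cons.inj H).2)]
    · rw [if_neg h, if_neg (fun H => h (List.cons.inj H).1)]

/-! ## §3 Powers of nested palindromes -/

/-- `PAL_t^j` is homogeneous of degree `2tj`. [cite: LimayeMalodSrinivasan2016, §1 (remark on `PAL²`)] -/
theorem degPart_palPow (t : ℕ) : ∀ (j : ℕ) {d : ℕ}, 2 * t * j ≤ d →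
    degPart d (2 * t * j) (palPoly R t ^ j) = palPoly R t ^ j := by
  intro j
  induction j with
  | zero =>
    intro d _
    rw [pow_zero, Nat.mul_zero]
    exact degPart_zero_one d
  | succ j ih =>
    intro d h
    have e : 2 * t * (j + 1) = 2 * t * j + 2 * t := by ring
    rw [pow_succ, e]
    exact degPart_mul_of_eq (ih (by omega)) (degPart_palPoly R t (by omega)) (by omega)

/-- The all-`0` word of length `2tj` has coefficient `1` in `PAL_t^j`. [cite: LimayeMalodSrinivasan2016, §1 (remark on `PAL²`)] -/
theorem coeff_replicate_palPow (t : ℕ) : ∀ j : ℕ,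
    coeff (List.replicate (2 * t * j) 0) (palPoly R t ^ j) = 1 := by
  intro j
  induction j with
  | zero =>
    rw [pow_zero, Nat.mul_zero, List.replicate_zero]
    exact coeff_nil_one
  | succ j ih =>
    have e : 2 * t * (j + 1) = 2 * t * j + 2 * t := by ring
    have hrep : List.replicate (2 * t) (0 : Fin 2) =
        List.replicate t 0 ++ (List.replicate t 0).reverse := by
      rw [List.reverse_replicate, List.replicate_append_replicate, two_mul]
    rw [pow_succ, e, ← List.replicate_append_replicate,
      coeff_append_mul (d := 2 * t * j + 2 * t) (a := 2 * t * j) (b := 2 * t) le_rfl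
        (List.replicate (2 * t * j) 0) (List.replicate (2 * t) 0) (by simp) (by simp)
        (degPart_palPow R t j (by omega)) (degPart_palPoly R t (by omega)),
      ih, hrep, coeff_palPoly R t _ _ (by simp) (by simp), if_pos rfl, one_mul]

/-- **Gluing**: `[A ++ A'ᴿ ++ 0^{2tj} ++ B'ᴿ ++ B] PAL_t^{j+2} = [A = A'][B = B']` — reading
`PAL_t^{j+2} = PAL_t · PAL_t^j · PAL_t`, the outer letters `A`, `B` are perfectly correlated with the
nearest middle letters. [cite: LimayeMalodSrinivasan2016, §1 (remark on `PAL²`), Lemma 5.4] -/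
theorem coeff_glue_palPow (t j : ℕ) (A B A' B' : Fin t → Fin 2) :
    coeff (List.ofFn A ++ (List.ofFn A').reverse ++ List.replicate (2 * t * j) 0 ++
        (List.ofFn B').reverse ++ List.ofFn B) (palPoly R t ^ (j + 2)) =
      if A = A' ∧ B = B' then 1 else 0 := by
  have e2 : palPoly R t ^ (j + 2) = palPoly R t * palPoly R t ^ j * palPoly R t := by
    rw [show j + 2 = j + 1 + 1 from rfl, pow_succ, pow_succ']
  have hq1 : degPart (2 * t * j + 4 * t) (2 * t) (palPoly R t) = palPoly R t :=
    degPart_palPoly R t (by omega)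
  have hp1 : degPart (2 * t * j + 4 * t) (2 * t + 2 * t * j) (palPoly R t * palPoly R t ^ j) =
      palPoly R t * palPoly R t ^ j :=
    degPart_mul_of_eq hq1 (degPart_palPow R t j (by omega)) (by omega)
  have hL : coeff (List.ofFn A ++ (List.ofFn A').reverse) (palPoly R t) = if A = A' then 1 else 0 := by
    rw [coeff_palPoly R t _ _ (by simp) (by simp)]
    by_cases h : A = A'
    · rw [if_pos h, if_pos (by rw [h])]
    · rw [if_neg h, if_neg (fun H => h (List.ofFn_inj.mp H))]
  have hR : coeff ((List.ofFn B').reverse ++ List.ofFn B) (palPoly R t) = if B = B' then 1 else 0 := by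
    have := coeff_palPoly R t (List.ofFn B').reverse (List.ofFn B).reverse (by simp) (by simp)
    rw [List.reverse_reverse] at this
    rw [this]
    by_cases h : B = B'
    · rw [if_pos h, if_pos (by rw [h])]
    · rw [if_neg h, if_neg (fun H => h (List.ofFn_inj.mp (List.reverse_inj.mp H)).symm)]
  rw [e2, List.append_assoc,
    coeff_append_mul (d := 2 * t * j + 4 * t) (a := 2 * t + 2 * t * j) (b := 2 * t) (by omega)
      (List.ofFn A ++ (List.ofFn A').reverse ++ List.replicate (2 * t * j) 0)
      ((List.ofFn B').reverse ++ List.ofFn B)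
      (by simp only [List.length_append, List.length_ofFn, List.length_reverse,
        List.length_replicate]; omega)
      (by simp only [List.length_append, List.length_ofFn, List.length_reverse]; omega) hp1 hq1,
    coeff_append_mul (d := 2 * t * j + 4 * t) (a := 2 * t) (b := 2 * t * j) (by omega)
      (List.ofFn A ++ (List.ofFn A').reverse) (List.replicate (2 * t * j) 0)
      (by simp only [List.length_append, List.length_ofFn, List.length_reverse]; omega) (by simp)
      hq1 (degPart_palPow R t j (by omega)),
    coeff_replicate_palPow, mul_one, hL, hR]
  by_cases hA : A = A' <;> by_cases hB : B = B' <;> simp [hA, hB]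

end Pal

/-! ## §4 The outer flattening of `PAL_t^{j+2}` has full row rank -/

section Flat

variable (K : Type u) [Field K]

/-- The `0/1` COLUMN SELECTION `C = A'ᴿ ++ 0^{2tj} ++ B'ᴿ ↤ (A', B')`: a right inverse of the outer
flattening of `PAL_t^{j+2}`. [cite: LimayeMalodSrinivasan2016, §1 (remark on `PAL²`)] -/
def palSel (t j : ℕ) :
    Matrix (Fin (2 * t * j + 2 * t) → Fin 2) ((Fin t → Fin 2) × (Fin t → Fin 2)) K :=
  fun C y => if List.ofFn C = (List.ofFn y.1).reverse ++ List.replicate (2 * t * j) 0 ++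
    (List.ofFn y.2).reverse then 1 else 0

/-- `M · S = 1` for the outer flattening `M` of `PAL_t^{j+2}` (`p = t`, `m = 2tj + 2t`) and the
column selection `S`. [cite: LimayeMalodSrinivasan2016, §1 (remark on `PAL²`), Lemma 5.4] -/
theorem outerFlat_palPow_mul_palSel (t j : ℕ) :
    outerFlat K t (2 * t * j + 2 * t) (palPoly K t ^ (j + 2)) * palSel K t j = 1 := by
  ext y y'
  obtain ⟨A, B⟩ := y
  obtain ⟨A', B'⟩ := y'
  obtain ⟨C₀, hC₀⟩ := exists_ofFn_eq ((List.ofFn A').reverse ++ List.replicate (2 * t * j) 0 ++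
      (List.ofFn B').reverse) (n := 2 * t * j + 2 * t)
    (by simp only [List.length_append, List.length_reverse, List.length_ofFn,
      List.length_replicate]; omega)
  have h1 : ∀ C : Fin (2 * t * j + 2 * t) → Fin 2,
      List.ofFn C = (List.ofFn A').reverse ++ List.replicate (2 * t * j) 0 ++
        (List.ofFn B').reverse ↔ C = C₀ :=
    fun C => by rw [← hC₀, List.ofFn_inj]
  rw [Matrix.mul_apply, Matrix.one_apply]
  simp only [palSel, h1, mul_ite, mul_one, mul_zero, Finset.sum_ite_eq', Finset.mem_univ, if_true]
  rw [outerFlat_apply, hC₀]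
  have key := coeff_glue_palPow K t j A B A' B'
  simp only [List.append_assoc] at key ⊢
  rw [key]
  by_cases hA : A = A' <;> by_cases hB : B = B' <;> simp [hA, hB]

/-- The outer flattening of `PAL_t^{j+2}` (`4^t` rows) has FULL ROW RANK `4^t`: the outer letters
are perfectly correlated with the adjacent middle letters. [cite: LimayeMalodSrinivasan2016, §1 (remark on `PAL²`), Lemma 5.4] -/
theorem rank_outerFlat_palPow (t j : ℕ) :
    (outerFlat K t (2 * t * j + 2 * t) (palPoly K t ^ (j + 2))).rank = 4 ^ t := by
  have hcard : Fintype.card ((Fin t → Fin 2) × (Fin t → Fin 2)) = 4 ^ t := by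
    simp only [Fintype.card_prod, Fintype.card_fun, Fintype.card_fin]
    exact (four_pow_eq_mul t).symm
  apply le_antisymm
  · exact (Matrix.rank_le_card_height _).trans hcard.le
  · have h := Matrix.rank_mul_le_left (outerFlat K t (2 * t * j + 2 * t) (palPoly K t ^ (j + 2)))
      (palSel K t j)
    rwa [outerFlat_palPow_mul_palSel, Matrix.rank_one, hcard] at h

/-! ## §5 Lower bounds at every notch of the dial -/

/-- **`PAL_t^{j+2}` IS EXPONENTIALLY HARD FOR `(w+2)`-UNBALANCED CIRCUITS** (every field, every
notch `w`): every fan-in-two noncommutative circuit computing `PAL_t^{j+2}`, `t ≥ 1`, whose product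
gates are `(w+2)`-unbalanced up to degree `2tj + 4t` — at each product gate, read after the gates
before it, the components of the two operands of degrees `b, b' ≥ w + 2`, `b + b' ≤ 2tj + 4t`,
multiply to zero — has **`2^t ≤ (t+1) · (w+1) 2^w · size`**. [cite: LimayeMalodSrinivasan2016, Cor. 5.7, Thm 5.5] -/
theorem palPow_unbalanced {t j w : ℕ} (ht : 1 ≤ t) (P : ArithCircuit K (Fin 2)) (h2 : P.IsFanInTwo)
    (hunb : ∀ (l₁ : List (Gate K (Fin 2))) (o o' : Operand K (Fin 2)) (l₂ : List (Gate K (Fin 2))),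
      P.gates = l₁ ++ Gate.prod [o, o'] :: l₂ → ∀ b b' : ℕ, w + 2 ≤ b → w + 2 ≤ b' →
        b + b' ≤ 2 * t * j + 4 * t →
        degPart (2 * t * j + 4 * t) b (o.ncEval (ncGateValues l₁)) *
          degPart (2 * t * j + 4 * t) b' (o'.ncEval (ncGateValues l₁)) = 0)
    (h : P.ncEval = palPoly K t ^ (j + 2)) : 2 ^ t ≤ (t + 1) * ((w + 1) * 2 ^ w) * P.size := by
  have e : 2 * t * (j + 2) = 2 * t * j + 4 * t := by ring
  have hF : degPart (2 * t * j + 4 * t) (2 * t * j + 4 * t) (palPoly K t ^ (j + 2)) =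
      palPoly K t ^ (j + 2) := by
    have := degPart_palPow K t (j + 2) (d := 2 * t * j + 4 * t) (by omega)
    rwa [e] at this
  have hmem : palPoly K t ^ (j + 2) ∈
      unbSpan (bodies (ncGateValues P.gates) (2 * t * j + 4 * t)) (2 * t * j + 4 * t)
        (t + (2 * t * j + 2 * t)) w (2 * t * j + 4 * t) := by
    have := unbalanced_structure P h2 (d := 2 * t * j + 4 * t) (e := t + (2 * t * j + 2 * t))
      (w := w) hunb (by omega) (by omega) (by rw [h]; exact hF)
    rwa [h] at this
  have hrank := rank_outerFlat_unb_le K (p := t) (m := 2 * t * j + 2 * t) (d := 2 * t * j + 4 * t)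
    (w := w) (by omega) (ncGateValues P.gates) hmem
  have hlen : (ncGateValues P.gates).length = P.size := by
    show _ = P.gates.length
    simpa using (ncGateValues_append_getD P.gates []).1
  rw [hlen, Fintype.card_fin] at hrank
  have hsum : ∑ i ∈ Finset.range (w + 1), 2 ^ (t + i) ≤ (w + 1) * 2 ^ w * 2 ^ t :=
    calc ∑ i ∈ Finset.range (w + 1), 2 ^ (t + i)
        ≤ (w + 1) * 2 ^ (t + w) := sum_pow_window_le 2 t w (by norm_num)
      _ = (w + 1) * 2 ^ w * 2 ^ t := by rw [pow_add]; ring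
  have h4 : 2 ^ t * 2 ^ t ≤ (t + 1) * ((w + 1) * 2 ^ w) * P.size * 2 ^ t :=
    calc 2 ^ t * 2 ^ t = 4 ^ t := (four_pow_eq_mul t).symm
      _ = (outerFlat K t (2 * t * j + 2 * t) (palPoly K t ^ (j + 2))).rank :=
          (rank_outerFlat_palPow K t j).symm
      _ ≤ P.size * (t + 1) * ∑ i ∈ Finset.range (w + 1), 2 ^ (t + i) := hrank
      _ ≤ P.size * (t + 1) * ((w + 1) * 2 ^ w * 2 ^ t) := Nat.mul_le_mul_left _ hsum
      _ = (t + 1) * ((w + 1) * 2 ^ w) * P.size * 2 ^ t := by ring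
  exact Nat.le_of_mul_le_mul_right h4 (by positivity)

/-- **DEF. 5.6 READ SEMANTICALLY** (`δ = w + 1`): if at every product gate of a fan-in-two
noncommutative circuit computing `PAL_t^{j+2}` (`t ≥ 1`) one operand's value has degree `≤ w + 1` (all
its components of degrees `w + 2 ≤ b ≤ 2tj + 4t + 1` vanish), then `2^t ≤ (t+1) · (w+1) 2^w · size`.
[cite: LimayeMalodSrinivasan2016, Def. 5.6, Cor. 5.7] -/
theorem palPow_degree {t j w : ℕ} (ht : 1 ≤ t) (P : ArithCircuit K (Fin 2)) (h2 : P.IsFanInTwo)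
    (hdeg : ∀ (l₁ : List (Gate K (Fin 2))) (o o' : Operand K (Fin 2)) (l₂ : List (Gate K (Fin 2))),
      P.gates = l₁ ++ Gate.prod [o, o'] :: l₂ →
        (∀ b : ℕ, w + 2 ≤ b → b ≤ 2 * t * j + 4 * t + 1 →
          degPart (2 * t * j + 4 * t) b (o.ncEval (ncGateValues l₁)) = 0) ∨
        (∀ b : ℕ, w + 2 ≤ b → b ≤ 2 * t * j + 4 * t + 1 →
          degPart (2 * t * j + 4 * t) b (o'.ncEval (ncGateValues l₁)) = 0))
    (h : P.ncEval = palPoly K t ^ (j + 2)) : 2 ^ t ≤ (t + 1) * ((w + 1) * 2 ^ w) * P.size :=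
  palPow_unbalanced K ht P h2 (unbalanced_of_degree P.gates hdeg) h

/-- **THE SKEW END** (`w = 0`): every fan-in-two SKEW noncommutative circuit computing `PAL_t^{j+2}`
(`t ≥ 1`) has `2^t ≤ (t+1) · size` — Nisan's palindrome is skew-easy, its powers are skew-hard.
[cite: LimayeMalodSrinivasan2016, Thm 5.5, §1 (remark on `PAL²`)] -/
theorem palPow_skew {t j : ℕ} (ht : 1 ≤ t) (P : ArithCircuit K (Fin 2)) (h2 : P.IsFanInTwo)
    (hs : P.IsSkew) (h : P.ncEval = palPoly K t ^ (j + 2)) : 2 ^ t ≤ (t + 1) * P.size := by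
  simpa using palPow_unbalanced K ht P h2 (w := 0) (skew_unbalanced P.gates hs) h

end Flat

end Summit.ValiantsHypothesis.ValiantsHypothesis.Theorems.NcPalindromePower

end
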